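import Summits.CriticalPhenomena.Ising3DConformalLimit.Theses.FKParityRobustness
import Literature.Probability.LatticeModels.CriticalTwoPointLower
import Literature.Probability.LatticeModels.RandomClusterFKG
import HarnessLib

/-!
# `ParityRobustMerging` (item stmt-CriticalPhenomena-11253): the H-world — no graph-uniform BLOB

Negative knowledge about the crux
`Summit.CriticalPhenomena.Ising3DConformalLimit.Theses.FKParityRobustness.ParityRobustMerging`
(standing crux disprover, cycle 1, D-0016): its NATURAL STRENGTHENING to all finite graphs — one
constant `c > 0` with `c·φ_G[all four sources joined] ≤ ∫ u_a dφ_G` for EVERY finite graph `G` and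
every injective source map `a`, at the same critical FK-Ising parameter and with the same parity
robustness `u` — is false (`not_graphUniformBLOB`).  Witness: the H-shaped tree on six vertices with
the four leaves as sources.  Parity at the hubs expels the bridge from every `T`-join of the leaves
(`hTree_tJoin_not_joinsAll`), so `u ≡ 0` identically, while the all-joined event has positive
probability (`hTree_allJoined_pos`, using `β_c(3) > 0`).  This is the formal "H-shaped merger": four
FK arms tied 2|2 through a bridge are parity-fragile; a proof of the crux must use the geometry of
`Λ_N ⊂ ℤ³`, not just finiteness, FKG or the FK ↔ loop dictionary (all of which hold on the H-tree).

Theorem-only file (the witness graph `hTree` = `fromEdgeSet {s(0,4), s(1,4), s(2,5), s(3,5), s(4,5)}` on `Fin 6`,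
sources `hSrc = ![0,1,2,3]`, edge set `hEdges`, all written out literally — no definitions, no notations).
-/

noncomputable section

namespace Summit.CriticalPhenomena.Ising3DConformalLimit.ParityRobustMergingNegative

open MeasureTheory Finset
open Literature.Probability.LatticeModels

/-- The four leaves are distinct sources. [folklore] -/
theorem hSrc_injective : Function.Injective (![0, 1, 2, 3] : Fin 4 → Fin 6) := by decide

/-- The source set is `{0,1,2,3}`. [folklore] -/
theorem image_hSrc : Finset.univ.image (![0, 1, 2, 3] : Fin 4 → Fin 6) = {0, 1, 2, 3} := by decide

/-- The H-tree has no loops. [folklore] -/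
theorem hEdges_not_isDiag : ∀ e ∈ ({s(0,4), s(1,4), s(2,5), s(3,5), s(4,5)} : Finset (Sym2 (Fin 6))), ¬ e.IsDiag := by decide

/-- The edge finset of the H-tree is `hEdges` (for every `Fintype` instance on its edge set). [folklore] -/
theorem hTree_edgeFinset {inst : Fintype (SimpleGraph.fromEdgeSet ((({s(0,4), s(1,4), s(2,5), s(3,5), s(4,5)} : Finset (Sym2 (Fin 6))) : Set (Sym2 (Fin 6))))).edgeSet} :
    @SimpleGraph.edgeFinset (Fin 6) (SimpleGraph.fromEdgeSet ((({s(0,4), s(1,4), s(2,5), s(3,5), s(4,5)} : Finset (Sym2 (Fin 6))) : Set (Sym2 (Fin 6))))) inst = ({s(0,4), s(1,4), s(2,5), s(3,5), s(4,5)} : Finset (Sym2 (Fin 6))) := by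
  ext e
  rw [SimpleGraph.mem_edgeFinset, SimpleGraph.edgeSet_fromEdgeSet]
  simp only [Set.mem_sdiff, Finset.mem_coe]
  exact ⟨fun h => h.1, fun h => ⟨h, hEdges_not_isDiag e h⟩⟩

/-- Walks stay inside a set closed under adjacency. [folklore] -/
theorem mem_of_reachable_of_closed {V : Type*} {G : SimpleGraph V} {S : Set V}
    (hS : ∀ u v, G.Adj u v → u ∈ S → v ∈ S) {u v : V} (h : G.Reachable u v) (hu : u ∈ S) : v ∈ S := by
  obtain ⟨p⟩ := h
  induction p with
  | nil => exact hu
  | cons hadj _ ih => exact ih (hS _ _ hadj hu)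

/-- A leaf edge is forced into `F` by odd parity at its leaf. [folklore] -/
theorem mem_of_odd_leaf {F : Finset (Sym2 (Fin 6))} (hF : F ⊆ ({s(0,4), s(1,4), s(2,5), s(3,5), s(4,5)} : Finset (Sym2 (Fin 6)))) {v : Fin 6} {e₀ : Sym2 (Fin 6)}
    (huniq : ∀ e ∈ ({s(0,4), s(1,4), s(2,5), s(3,5), s(4,5)} : Finset (Sym2 (Fin 6))), v ∈ e → e = e₀) (hodd : Odd (F.filter (fun e => v ∈ e)).card) : e₀ ∈ F := by
  have hsub : F.filter (fun e => v ∈ e) ⊆ {e₀} := by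
    intro e he
    rw [Finset.mem_filter] at he
    rw [Finset.mem_singleton]
    exact huniq e (hF he.1) he.2
  have hle : (F.filter (fun e => v ∈ e)).card ≤ 1 := by
    simpa using Finset.card_le_card hsub
  have h1 : (F.filter (fun e => v ∈ e)).card = 1 := by
    rcases hodd with ⟨k, hk⟩
    omega
  obtain ⟨e, he⟩ := Finset.card_eq_one.1 h1
  have hein : e ∈ F.filter (fun e => v ∈ e) := by rw [he]; exact Finset.mem_singleton_self e
  have : e = e₀ := Finset.mem_singleton.1 (hsub hein)
  subst this
  exact (Finset.mem_filter.1 hein).1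

/-- **The H-world.** On the H-tree every `T`-join of the four leaves inside ANY edge set consists of the
four leaf edges (parity at the hubs expels the bridge), hence never joins the leaves `0` and `2`. [folklore] -/
theorem hTree_tJoin_not_joinsAll (F : Finset (Sym2 (Fin 6))) (hF : F ⊆ ({s(0,4), s(1,4), s(2,5), s(3,5), s(4,5)} : Finset (Sym2 (Fin 6))))
    (hpar : ∀ v, Odd (F.filter (fun e => v ∈ e)).card ↔ v ∈ Finset.univ.image (![0, 1, 2, 3] : Fin 4 → Fin 6)) :
    ¬ ∀ i j, (SimpleGraph.fromEdgeSet (↑F : Set (Sym2 (Fin 6)))).Reachable ((![0, 1, 2, 3] : Fin 4 → Fin 6) i) ((![0, 1, 2, 3] : Fin 4 → Fin 6) j) := by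
  rw [image_hSrc] at hpar
  have h04 : s(0,4) ∈ F := mem_of_odd_leaf hF (by decide) ((hpar 0).2 (by decide))
  have h14 : s(1,4) ∈ F := mem_of_odd_leaf hF (by decide) ((hpar 1).2 (by decide))
  -- the bridge is not in F: otherwise vertex 4 has degree 3
  have h45 : s(4,5) ∉ F := by
    intro h45
    have hsub : ({s(0,4), s(1,4), s(4,5)} : Finset (Sym2 (Fin 6))) ⊆ F.filter (fun e => (4 : Fin 6) ∈ e) := by
      intro e he
      simp only [Finset.mem_insert, Finset.mem_singleton] at he
      rw [Finset.mem_filter]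
      rcases he with rfl | rfl | rfl
      · exact ⟨h04, by decide⟩
      · exact ⟨h14, by decide⟩
      · exact ⟨h45, by decide⟩
    have hsup : F.filter (fun e => (4 : Fin 6) ∈ e) ⊆ ({s(0,4), s(1,4), s(4,5)} : Finset (Sym2 (Fin 6))) := by
      intro e he
      rw [Finset.mem_filter] at he
      have : ∀ e ∈ ({s(0,4), s(1,4), s(2,5), s(3,5), s(4,5)} : Finset (Sym2 (Fin 6))), (4 : Fin 6) ∈ e → e ∈ ({s(0,4), s(1,4), s(4,5)} : Finset (Sym2 (Fin 6))) := by
        decide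
      exact this e (hF he.1) he.2
    have heq : F.filter (fun e => (4 : Fin 6) ∈ e) = {s(0,4), s(1,4), s(4,5)} :=
      Finset.Subset.antisymm hsup hsub
    have hcard : (F.filter (fun e => (4 : Fin 6) ∈ e)).card = 3 := by rw [heq]; decide
    have hodd : Odd (F.filter (fun e => (4 : Fin 6) ∈ e)).card := by rw [hcard]; decide
    exact absurd ((hpar 4).1 hodd) (by decide)
  -- S = {0,1,4} is closed in the graph spanned by F
  intro hconn
  have hS : ∀ u v, (SimpleGraph.fromEdgeSet (↑F : Set (Sym2 (Fin 6)))).Adj u v →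
      u ∈ (↑({0, 1, 4} : Finset (Fin 6)) : Set (Fin 6)) → v ∈ (↑({0, 1, 4} : Finset (Fin 6)) : Set (Fin 6)) := by
    intro u v huv hu
    rw [SimpleGraph.fromEdgeSet_adj, Finset.mem_coe] at huv
    rw [Finset.mem_coe] at hu ⊢
    have he : s(u, v) ∈ ({s(0,4), s(1,4), s(2,5), s(3,5), s(4,5)} : Finset (Sym2 (Fin 6))) := hF huv.1
    have hne : s(u, v) ≠ s(4,5) := fun h => h45 (h ▸ huv.1)
    clear huv
    revert u v
    decide
  have h2 := mem_of_reachable_of_closed hS (hconn 0 2) (by decide)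
  rw [Finset.mem_coe] at h2
  exact absurd h2 (by decide)


/-- All four leaves are joined in the H-tree itself. [folklore] -/
theorem hTree_reachable : ∀ i j, (SimpleGraph.fromEdgeSet ((({s(0,4), s(1,4), s(2,5), s(3,5), s(4,5)} : Finset (Sym2 (Fin 6))) : Set (Sym2 (Fin 6))))).Reachable ((![0, 1, 2, 3] : Fin 4 → Fin 6) i) ((![0, 1, 2, 3] : Fin 4 → Fin 6) j) := by decide

/-- `p_c = 1 - e^{-2β_c(3)} > 0`, from `β_c(3) > 0` (`criticalBeta_pos_holds`). [folklore] -/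
theorem fkIsingParam_criticalBeta_pos : 0 < fkIsingParam (criticalBeta 3) := by
  have hβ : 0 < criticalBeta 3 := criticalBeta_pos_holds (d := 3) (by norm_num)
  have : Real.exp (-2 * criticalBeta 3) < 1 := Real.exp_lt_one_iff.2 (by linarith)
  simp only [fkIsingParam]; linarith

/-- `1 - e^{-2β} < 1`. [folklore] -/
theorem fkIsingParam_lt_one (β : ℝ) : fkIsingParam β < 1 := by
  have := Real.exp_pos (-2 * β)
  simp only [fkIsingParam]; linarith

open scoped Classical in
/-- The all-joined event has positive probability under the H-tree's FK-Ising measure (the all-open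
configuration alone has positive weight). [folklore] -/
theorem hTree_allJoined_pos :
    0 < (rcMeasure (SimpleGraph.fromEdgeSet ((({s(0,4), s(1,4), s(2,5), s(3,5), s(4,5)} : Finset (Sym2 (Fin 6))) : Set (Sym2 (Fin 6))))) (fkIsingParam (criticalBeta 3)) 2 ∅).real
      {ω | ∀ i j, (Literature.Probability.Percolation.openGraph ω).Reachable ((![0, 1, 2, 3] : Fin 4 → Fin 6) i) ((![0, 1, 2, 3] : Fin 4 → Fin 6) j)} := by
  set p := fkIsingParam (criticalBeta 3) with hp_def
  have hp : p ∈ Set.Icc (0 : ℝ) 1 := fkIsingParam_mem_Icc (criticalBeta_nonneg 3)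
  have hp0 : 0 < p := fkIsingParam_criticalBeta_pos
  have hp1 : 0 < 1 - p := sub_pos.2 (fkIsingParam_lt_one _)
  have hq : (0 : ℝ) < 2 := by norm_num
  have hZ := rcPartitionFunction_pos (SimpleGraph.fromEdgeSet ((({s(0,4), s(1,4), s(2,5), s(3,5), s(4,5)} : Finset (Sym2 (Fin 6))) : Set (Sym2 (Fin 6))))) hp hq ∅
  rw [rcMeasure_real_apply (SimpleGraph.fromEdgeSet ((({s(0,4), s(1,4), s(2,5), s(3,5), s(4,5)} : Finset (Sym2 (Fin 6))) : Set (Sym2 (Fin 6))))) hp hq ∅]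
  refine lt_of_lt_of_le ?_ (Finset.single_le_sum (fun ω _ => ?_) (Finset.mem_powerset_self _))
  · rw [if_pos ?hall]
    case hall =>
      simp only [Set.mem_setOf_eq, Literature.Probability.Percolation.openGraph, SimpleGraph.coe_edgeFinset,
        SimpleGraph.fromEdgeSet_edgeSet]
      exact hTree_reachable
    refine div_pos ?_ hZ
    simp only [rcWeight]
    exact mul_pos (mul_pos (pow_pos hp0 _) (pow_pos hp1 _)) (pow_pos two_pos _)
  · split_ifs
    · exact div_nonneg (rcWeight_nonneg (SimpleGraph.fromEdgeSet ((({s(0,4), s(1,4), s(2,5), s(3,5), s(4,5)} : Finset (Sym2 (Fin 6))) : Set (Sym2 (Fin 6))))) hp hq.le ∅ ω) hZ.le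
    · exact le_rfl

open scoped Classical in
/-- **No graph-uniform BLOB (the H-world).**  The natural strengthening of the crux to ALL finite graphs —
one constant `c > 0` with `c·φ_G[all aᵢ joined] ≤ ∫ u_a dφ_G` for every finite graph `G` and every
injective source map `a` (same critical FK-Ising parameter, same `u`) — is FALSE: on the H-shaped tree
(`hTree`, sources = the four leaves) every `T`-join of the leaves inside any `ω` is the set of the four
leaf edges (`hTree_tJoin_not_joinsAll`), so `u ≡ 0`, while the all-joined event has positive
probability (`hTree_allJoined_pos`).  This is the formal H-shaped merger: four FK-arms tied 2|2 through
a bridge are parity-fragile.  Any proof of the crux must use the geometry of `Λ_N ⊂ ℤ³` beyond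
finiteness. [folklore] -/
theorem not_graphUniformBLOB :
    ¬ ∃ c : ℝ, 0 < c ∧ ∀ (V : Type) [Fintype V] [DecidableEq V] (G : SimpleGraph V) [DecidableRel G.Adj]
      (a : Fin 4 → V), Function.Injective a →
  (let φ := Literature.Probability.LatticeModels.rcMeasure G (Literature.Probability.LatticeModels.fkIsingParam (Literature.Probability.LatticeModels.criticalBeta 3)) 2 ∅; let sol : Set (Sym2 V) → Finset (Finset (Sym2 V)) := fun ω => G.edgeFinset.powerset.filter (fun F => (↑F : Set (Sym2 V)) ⊆ ω ∧ ∀ v, Odd (F.filter (fun e => v ∈ e)).card ↔ v ∈ Finset.univ.image a); let u : Set (Sym2 V) → ℝ := fun ω => (((sol ω).filter (fun F => ∀ i j, (SimpleGraph.fromEdgeSet (↑F : Set (Sym2 V))).Reachable (a i) (a j))).card : ℝ) / ((sol ω).card : ℝ); c * φ.real {ω | ∀ i j, (Literature.Probability.Percolation.openGraph ω).Reachable (a i) (a j)} ≤ ∫ ω, u ω ∂φ) := by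
  rintro ⟨c, hc, h⟩
  have key := h (Fin 6) (SimpleGraph.fromEdgeSet ((({s(0,4), s(1,4), s(2,5), s(3,5), s(4,5)} : Finset (Sym2 (Fin 6))) : Set (Sym2 (Fin 6))))) (![0, 1, 2, 3] : Fin 4 → Fin 6) hSrc_injective
  simp only at key
  have hint : c * (rcMeasure (SimpleGraph.fromEdgeSet ((({s(0,4), s(1,4), s(2,5), s(3,5), s(4,5)} : Finset (Sym2 (Fin 6))) : Set (Sym2 (Fin 6))))) (fkIsingParam (criticalBeta 3)) 2 ∅).real
      {ω | ∀ i j, (Literature.Probability.Percolation.openGraph ω).Reachable ((![0, 1, 2, 3] : Fin 4 → Fin 6) i) ((![0, 1, 2, 3] : Fin 4 → Fin 6) j)} ≤ 0 := by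
    refine key.trans_eq (integral_eq_zero_of_ae (Filter.Eventually.of_forall fun ω => ?_))
    simp only [Pi.zero_apply]
    refine div_eq_zero_iff.2 (Or.inl ?_)
    rw [Nat.cast_eq_zero, Finset.card_eq_zero, Finset.filter_eq_empty_iff]
    intro s hs hconn
    obtain ⟨F, hF, hsF⟩ := Finset.mem_sup.1 hs
    have hsF' : s = ↑F := Finset.mem_singleton.1 hsF
    subst hsF'
    simp only [Finset.mem_filter, Finset.mem_powerset] at hF
    have hFE : F ⊆ ({s(0,4), s(1,4), s(2,5), s(3,5), s(4,5)} : Finset (Sym2 (Fin 6))) := by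
      have h1 := hF.1
      rwa [hTree_edgeFinset] at h1
    exact hTree_tJoin_not_joinsAll F hFE hF.2.2 hconn
  have hpos := hTree_allJoined_pos
  nlinarith


end Summit.CriticalPhenomena.Ising3DConformalLimit.ParityRobustMergingNegative

end
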